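import Mathlib
import Summits.NavierStokesRegularity.NavierStokesRegularity.Theorems.EulerZoomLiouvillePowerGaugeEulerLiouvilleCasimirFloorEndgame
import Summits.NavierStokesRegularity.NavierStokesRegularity.Theorems.EulerZoomLiouvillePowerGaugeEulerLiouvilleBackwardTools
import Literature.Analysis.FluidPDE.ClassicalSolution
import Literature.Analysis.FluidPDE.VorticityCalculus
import HarnessLib

/-!
# Crux `EulerZoomLiouville.PowerGaugeEulerLiouville` (stmt-NavierStokesRegularity-19832), line `helicity-tube`, stub T2:
# THE ZERO-HELICITY LAW — on a drifting classical far past above the helicity drift threshold every persistent coherent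
# vortex tube has zero weighted (Moffatt) helicity

Route №10 `EulerZoomLiouville` (NavierStokesRegularity), crux E.  Line `helicity-tube` (ideator ns-idea-11 g4;
`Cruxes/PowerGaugeEulerLiouville/Lines/helicity_tube.lean`, card `Lines/helicity-tube.md`), registered stub `stub_helicityStarvation`
(T2, "the theorem of the line"), proved here with its signature `δ`-UNFOLDED in the tree's vocabulary (the line's `InClass`,
`IsDriftingPastWith`, `helicityDriftThreshold`, `TubesPersist`, `IsTubeWeight`, `weightedHelicity`, `driftRadius` are `def`s of the Cruxes
file, which a Theorems file cannot import; the statement below is their unfolding, binder for binder, so the skeleton fills the stub by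
`theorem stub_helicityStarvation : Sig.stub_helicityStarvation := HelicityTube.weightedHelicity_eq_zero_of_tubesPersist`).

THE ARGUMENT (card T2, verbatim up to constants).  Let `(u,p,H,c)` be a member of the power-gauged class, `0 < ρ ≤ 1/2`, with a drifting
classical far past `(T₁, M, κ)` — `‖u(τ,x)‖ ≤ M(−τ)^{−κ}` for `τ < T₁`, `κ < 1` — of exponent `κ > κ_𝓗(ρ) = (1−3ρ)/(2−3ρ)`, on which tube
data persist backward with their helicity (the conclusion shape of T1).  Suppose a tube datum `(χ, R)` at a time `τ < T₁` had weighted helicity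
`h = ∫ χ ⟪u(τ), curl u(τ)⟫ ≠ 0`.  For every `s < τ` its avatar `χ'_s` is a tube datum for `u(s)` inside `B(0, R(s))`,
`R(s) = R + M((−s)^{1−κ} − (−τ)^{1−κ})/(1−κ)`, with the same helicity, so by Cauchy–Schwarz (`|χ'| ≤ 1`, `χ' = 0` off the ball)
`h² ≤ (∫_{B(R(s))} |u(s)|²) · (∫_{B(R(s))} |curl u(s)|²)` (`sq_integral_le_lintegral_mul_lintegral`).  Take `a` large and the usable window
`s ∈ (−L_a, τ)`, `L_a = min (a², (c₁a)^{1/(1−κ)})`, `c₁ = (1−κ)/(4(M+1))`: there `−a² < s`, and the drift is `≤ a/4`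
(`CasimirFloor.drift_le_quarter`, sibling line `casimir-floor`), so `R(s) ≤ a` once `a ≥ 2R`; the `A`-gauge on the slice
(`Backward.lintegral_ball_le_of_gaugeA`) gives `∫_{B(a)}|u(s)|² ≤ c a^{1−2ρ} ≤ (c+1) a^{1−2ρ}`, hence the ENSTROPHY FLOOR
`∫_{B(a)} |curl u(s)|² ≥ h² / ((c+1) a^{1−2ρ})` on every slice of the window.  Integrating in `s` against the windowed enstrophy budget of the
`E`-gauge, `∫_{−a²}^{0}∫_{B(a)} |curl u|² ≤ 16 c a^{1−ρ}` (`CasimirFloor.lintegral_window_sq_curl_le`), yields `(τ + L_a) h² ≤ 16 (c+1)² a^{2−3ρ}`.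
But `L_a ≥ c₂ a^γ`, `γ = min (2, 1/(1−κ)) > 0`, `c₂ = min (1, c₁^{1/(1−κ)})`, and for `a` large `L_a ≥ 2|τ|`, so `c₂ h² a^γ ≤ 32 (c+1)² a^{2−3ρ}`,
i.e. `a^{γ−(2−3ρ)}` stays bounded — absurd, because the EXPONENT RACE `min (2, 1/(1−κ)) > 2 − 3ρ ⇔ (ρ > 0 and) κ > (1−3ρ)/(2−3ρ)` makes the
exponent positive.  Hence `h = 0`.

* `sq_integral_le_lintegral_mul_lintegral` — the Cauchy–Schwarz step, in `ℝ≥0∞` form;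
* `window_le_rpow_min`, `exponent_race` — the real-variable bookkeeping (`L_a ≥ c₂ a^γ`; the race);
* **`weightedHelicity_eq_zero_of_tubesPersist`** — the stub signature, unfolded.

WHAT THIS IS NOT: not NS, not the crux — a helper `--supports` stmt-19832 on the line `helicity-tube` (a statement about a hypothetical
Euler zoom-limit class: the stratum `IsHelicalTubePast` is empty GIVEN the transport stub T1); the residue T3 (`stub_helicityRest`, members
outside the stratum) stays OPEN; 19832 is a crux CLASS on the model lattice (E/NS strata); no summit statement is proved here and nothing here
bears on NS regularity itself.  [folklore; cite: MajdaBertozziCUP2002 §1.6 Prop. 1.12 (helicity), CaffarelliKohnNirenberg1982 §2 (scaled quantities)]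
-/

noncomputable section

-- flat `Theorems/<Route><Decl>…` files of one crux share the namespace of the crux (tree convention)
set_option linter.dupNamespace false

open MeasureTheory Set Filter Topology Metric Function Real InnerProductSpace
open scoped NNReal ENNReal RealInnerProductSpace ContDiff

namespace Summit.NavierStokesRegularity.NavierStokesRegularity.Theorems.PowerGaugeEulerLiouville.HelicityTube

open Literature.Analysis Literature.Analysis.FluidPDE
open Summit.NavierStokesRegularity.NavierStokesRegularity.Theorems.PowerGaugeEulerLiouville.CasimirFloor

/-! ### Cauchy–Schwarz for a weighted helicity -/

/-- **Cauchy–Schwarz for a weighted helicity**, `ℝ≥0∞` form: if `|χ| ≤ 1` and `χ = 0` outside the open ball `B(0,R')`, and `v`, `curl v` are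
measurable, then `(∫ χ ⟪v, curl v⟫)² ≤ (∫_{B(0,R')} ‖v‖²) · (∫_{B(0,R')} ‖curl v‖²)` (the Bochner integral on the left is bounded by the lower
integral of the norm of its integrand whether or not it is integrable; then Hölder with exponents `2, 2`). [folklore] -/
theorem sq_integral_le_lintegral_mul_lintegral {v : EuclideanSpace ℝ (Fin 3) → EuclideanSpace ℝ (Fin 3)}
    (hv : Measurable v) (hcv : Measurable (curl v)) {χ : EuclideanSpace ℝ (Fin 3) → ℝ} {R' : ℝ}
    (hχ1 : ∀ x, |χ x| ≤ 1) (hχ0 : ∀ x, R' ≤ ‖x‖ → χ x = 0) :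
    ENNReal.ofReal ((∫ x, χ x * ⟪v x, curl v x⟫) ^ 2) ≤
      (∫⁻ x in ball (0 : EuclideanSpace ℝ (Fin 3)) R', ‖v x‖ₑ ^ 2) *
        ∫⁻ x in ball (0 : EuclideanSpace ℝ (Fin 3)) R', ENNReal.ofReal (‖curl v x‖ ^ 2) := by
  set B : Set (EuclideanSpace ℝ (Fin 3)) := ball 0 R' with hB
  set h : ℝ := ∫ x, χ x * ⟪v x, curl v x⟫ with hh
  -- pointwise domination of the integrand by the indicator of the ball times `‖v‖ ‖curl v‖`
  have hpt : ∀ x, ‖χ x * ⟪v x, curl v x⟫‖ₑ ≤ B.indicator (fun y => ‖v y‖ₑ * ‖curl v y‖ₑ) x := by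
    intro x
    by_cases hx : x ∈ B
    · rw [indicator_of_mem hx, Real.enorm_eq_ofReal_abs, ← ofReal_norm, ← ofReal_norm,
        ← ENNReal.ofReal_mul (norm_nonneg _)]
      refine ENNReal.ofReal_le_ofReal ?_
      rw [abs_mul]
      calc |χ x| * |⟪v x, curl v x⟫| ≤ 1 * (‖v x‖ * ‖curl v x‖) :=
            mul_le_mul (hχ1 x) (abs_real_inner_le_norm _ _) (abs_nonneg _) zero_le_one
        _ = ‖v x‖ * ‖curl v x‖ := one_mul _
    · have hR : R' ≤ ‖x‖ := by
        rw [hB, mem_ball, dist_zero_right, not_lt] at hx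
        exact hx
      rw [indicator_of_notMem hx, hχ0 x hR, zero_mul, enorm_zero]
  -- `‖h‖ₑ ≤ ∫⁻_B ‖v‖ₑ ‖curl v‖ₑ`
  have h1 : ‖h‖ₑ ≤ ∫⁻ x in B, ‖v x‖ₑ * ‖curl v x‖ₑ := by
    calc ‖h‖ₑ ≤ ∫⁻ x, ‖χ x * ⟪v x, curl v x⟫‖ₑ := enorm_integral_le_lintegral_enorm _
      _ ≤ ∫⁻ x, B.indicator (fun y => ‖v y‖ₑ * ‖curl v y‖ₑ) x := lintegral_mono hpt
      _ = ∫⁻ x in B, ‖v x‖ₑ * ‖curl v x‖ₑ := lintegral_indicator measurableSet_ball _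
  -- Hölder `2, 2` on the ball
  set μ : Measure (EuclideanSpace ℝ (Fin 3)) := volume.restrict B with hμ
  have hfm : AEMeasurable (fun x => ‖v x‖ₑ) μ := hv.enorm.aemeasurable
  have hgm : AEMeasurable (fun x => ‖curl v x‖ₑ) μ := hcv.enorm.aemeasurable
  have hcs := ENNReal.lintegral_mul_le_Lp_mul_Lq μ Real.HolderConjugate.two_two hfm hgm
  simp only [Pi.mul_apply, ENNReal.rpow_two] at hcs
  have h2 : ‖h‖ₑ ^ 2 ≤ (∫⁻ x, ‖v x‖ₑ ^ 2 ∂μ) * ∫⁻ x, ‖curl v x‖ₑ ^ 2 ∂μ := by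
    calc ‖h‖ₑ ^ 2 ≤ (∫⁻ x, ‖v x‖ₑ * ‖curl v x‖ₑ ∂μ) ^ 2 := by gcongr
      _ ≤ ((∫⁻ x, ‖v x‖ₑ ^ 2 ∂μ) ^ (1 / 2 : ℝ) * (∫⁻ x, ‖curl v x‖ₑ ^ 2 ∂μ) ^ (1 / 2 : ℝ)) ^ 2 := by gcongr
      _ = (∫⁻ x, ‖v x‖ₑ ^ 2 ∂μ) * ∫⁻ x, ‖curl v x‖ₑ ^ 2 ∂μ := by
          rw [← ENNReal.mul_rpow_of_nonneg _ _ (by norm_num : (0 : ℝ) ≤ 1 / 2), ← ENNReal.rpow_two,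
            ← ENNReal.rpow_mul]
          norm_num
  -- rewrite both sides
  have hlhs : ENNReal.ofReal (h ^ 2) = ‖h‖ₑ ^ 2 := by
    rw [Real.enorm_eq_ofReal_abs, ← ENNReal.ofReal_pow (abs_nonneg _), sq_abs]
  have hrhs : ∫⁻ x, ‖curl v x‖ₑ ^ 2 ∂μ = ∫⁻ x in B, ENNReal.ofReal (‖curl v x‖ ^ 2) := by
    refine lintegral_congr fun x => ?_
    rw [← ofReal_norm, ENNReal.ofReal_pow (norm_nonneg _)]
  rw [hlhs, ← hrhs]
  exact h2

/-! ### Real-variable bookkeeping -/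

/-- The usable window length `L_a = min (a², (c₁ a)^{1/(1−κ)})` is at least `c₂ a^γ` with `γ = min (2, 1/(1−κ))`,
`c₂ = min (1, c₁^{1/(1−κ)})`, for `a ≥ 1`, `c₁ > 0`, `κ < 1` (no sign condition on `κ`). [folklore] -/
theorem window_le_rpow_min {a κ c₁ : ℝ} (ha1 : 1 ≤ a) (hc₁0 : 0 < c₁) :
    min 1 (c₁ ^ (1 - κ)⁻¹) * a ^ min 2 (1 - κ)⁻¹ ≤ min (a ^ 2) ((c₁ * a) ^ (1 - κ)⁻¹) := by
  have ha0 : 0 < a := by linarith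
  have hγ0 : 0 ≤ a ^ min 2 (1 - κ)⁻¹ := Real.rpow_nonneg ha0.le _
  refine le_min ?_ ?_
  · have h1 : a ^ min 2 (1 - κ)⁻¹ ≤ a ^ (2 : ℝ) := Real.rpow_le_rpow_of_exponent_le ha1 (min_le_left _ _)
    rw [Real.rpow_two] at h1
    calc min 1 (c₁ ^ (1 - κ)⁻¹) * a ^ min 2 (1 - κ)⁻¹ ≤ 1 * a ^ min 2 (1 - κ)⁻¹ :=
          mul_le_mul_of_nonneg_right (min_le_left _ _) hγ0
      _ ≤ a ^ 2 := by rw [one_mul]; exact h1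
  · have h1 : a ^ min 2 (1 - κ)⁻¹ ≤ a ^ (1 - κ)⁻¹ := Real.rpow_le_rpow_of_exponent_le ha1 (min_le_right _ _)
    have h3 : 0 ≤ c₁ ^ (1 - κ)⁻¹ := Real.rpow_nonneg hc₁0.le _
    rw [Real.mul_rpow hc₁0.le ha0.le]
    calc min 1 (c₁ ^ (1 - κ)⁻¹) * a ^ min 2 (1 - κ)⁻¹ ≤ c₁ ^ (1 - κ)⁻¹ * a ^ min 2 (1 - κ)⁻¹ :=
          mul_le_mul_of_nonneg_right (min_le_right _ _) hγ0
      _ ≤ c₁ ^ (1 - κ)⁻¹ * a ^ (1 - κ)⁻¹ := mul_le_mul_of_nonneg_left h1 h3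

/-- **The exponent race of the line** (restated from the Cruxes file, which a Theorems file cannot import): for `κ < 1` and `0 < ρ < 2/3`,
`κ > (1−3ρ)/(2−3ρ)` implies `min (2, 1/(1−κ)) > 2 − 3ρ`. [folklore] -/
theorem exponent_race {ρ κ : ℝ} (hκ : κ < 1) (hρ : 0 < ρ) (hρ2 : ρ < 2 / 3) (h : (1 - 3 * ρ) / (2 - 3 * ρ) < κ) :
    2 - 3 * ρ < min 2 (1 - κ)⁻¹ := by
  have h1 : 0 < 1 - κ := by linarith
  have h2 : 0 < 2 - 3 * ρ := by linarith
  refine lt_min (by linarith) ?_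
  rw [← one_div, lt_div_iff₀ h1]
  have h' := (div_lt_iff₀ h2).1 h
  nlinarith

/-! ### The stub, unfolded -/

/-- **T2 `stub_helicityStarvation` of the line `helicity-tube`, signature unfolded — THE ZERO-HELICITY LAW.**  For a member `(u,p,H,c)` of
the power-gauged class (`0 < ρ ≤ 1/2`) with a drifting classical far past `(T₁, M, κ)` (`‖u(τ,·)‖_∞ ≤ M(−τ)^{−κ}` for `τ < T₁ ≤ 0`, `κ < 1`,
gradient bounded on compact time sets) of exponent `κ > (1−3ρ)/(2−3ρ)`, on which tube data persist backward with their helicity (for every tube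
datum `(χ, R)` of `u(τ)`, `τ < T₁`, and every `s < τ` there is a tube datum `χ'` of `u(s)` inside `B(0, R + M((−s)^{1−κ} − (−τ)^{1−κ})/(1−κ))`
with `∫ χ' ⟪u(s), curl u(s)⟫ = ∫ χ ⟪u(τ), curl u(τ)⟫`), EVERY tube datum `(χ, R)` (`χ ∈ C^∞`, `|χ| ≤ 1`, `χ = 0` off `B(0,R)`, `Dχ[curl u(τ)] ≡ 0`)
at every time `τ < T₁` has zero weighted helicity: `∫ χ ⟪u(τ), curl u(τ)⟫ = 0`.  Proof in the module docstring (enstrophy floor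
`h²/((c+1)a^{1−2ρ})` on the usable window versus the windowed `E`-budget `16 c a^{1−ρ}`; exponent race). [folklore] -/
theorem weightedHelicity_eq_zero_of_tubesPersist :
    ∀ ρ : ℝ, 0 < ρ → ρ ≤ 1 / 2 →
      ∀ (u : ℝ → EuclideanSpace ℝ (Fin 3) → EuclideanSpace ℝ (Fin 3)) (p : ℝ → EuclideanSpace ℝ (Fin 3) → ℝ)
        (H : ℝ → EuclideanSpace ℝ (Fin 3) → EuclideanSpace ℝ (Fin 3) →L[ℝ] EuclideanSpace ℝ (Fin 3)) (c : ℝ≥0),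
        (IsSuitableWeakSolutionOn (slab (EuclideanSpace ℝ (Fin 3)) (Set.Iio 0) isOpen_Iio) 0 0 u p ∧
            HasWeakSpatialGradientOn (slab (EuclideanSpace ℝ (Fin 3)) (Set.Iio 0) isOpen_Iio) u H ∧
            (∀ a : ℝ, 0 < a →
              ENNReal.ofReal (a ^ (2 * ρ)) * cknA a (0 : ℝ × EuclideanSpace ℝ (Fin 3)) u +
                    ENNReal.ofReal (a ^ ρ) * cknE a (0 : ℝ × EuclideanSpace ℝ (Fin 3)) H +
                  ENNReal.ofReal (a ^ (2 * ρ)) * cknD a (0 : ℝ × EuclideanSpace ℝ (Fin 3)) p ≤ (c : ℝ≥0∞))) →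
          ∀ (T₁ M κ : ℝ),
            (IsClassicalEulerSolutionOn (Set.Iio 0) 0 u p ∧ T₁ ≤ 0 ∧ 0 ≤ M ∧ κ < 1 ∧
                (∀ τ : ℝ, τ < T₁ → ∀ x : EuclideanSpace ℝ (Fin 3), ‖u τ x‖ ≤ M * (-τ) ^ (-κ)) ∧
                (∀ t₁ t₂ : ℝ, t₁ < t₂ → t₂ < 0 →
                  ∃ L : ℝ, ∀ τ ∈ Set.Icc t₁ t₂, ∀ x : EuclideanSpace ℝ (Fin 3), ‖fderiv ℝ (u τ) x‖ ≤ L)) →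
              (1 - 3 * ρ) / (2 - 3 * ρ) < κ →
                (∀ τ : ℝ, τ < T₁ → ∀ (χ : EuclideanSpace ℝ (Fin 3) → ℝ) (R : ℝ), 0 < R →
                    (ContDiff ℝ ∞ χ ∧ (∀ x : EuclideanSpace ℝ (Fin 3), |χ x| ≤ 1) ∧
                        (∀ x : EuclideanSpace ℝ (Fin 3), R ≤ ‖x‖ → χ x = 0) ∧
                        ∀ x : EuclideanSpace ℝ (Fin 3), fderiv ℝ χ x (curl (u τ) x) = 0) →
                      ∀ s : ℝ, s < τ →
                        ∃ χ' : EuclideanSpace ℝ (Fin 3) → ℝ,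
                          (ContDiff ℝ ∞ χ' ∧ (∀ x : EuclideanSpace ℝ (Fin 3), |χ' x| ≤ 1) ∧
                              (∀ x : EuclideanSpace ℝ (Fin 3),
                                R + M / (1 - κ) * ((-s) ^ (1 - κ) - (-τ) ^ (1 - κ)) ≤ ‖x‖ → χ' x = 0) ∧
                              ∀ x : EuclideanSpace ℝ (Fin 3), fderiv ℝ χ' x (curl (u s) x) = 0) ∧
                            ∫ x, χ' x * ⟪u s x, curl (u s) x⟫ = ∫ x, χ x * ⟪u τ x, curl (u τ) x⟫) →
                  ∀ τ : ℝ, τ < T₁ → ∀ (χ : EuclideanSpace ℝ (Fin 3) → ℝ) (R : ℝ), 0 < R →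
                    (ContDiff ℝ ∞ χ ∧ (∀ x : EuclideanSpace ℝ (Fin 3), |χ x| ≤ 1) ∧
                        (∀ x : EuclideanSpace ℝ (Fin 3), R ≤ ‖x‖ → χ x = 0) ∧
                        ∀ x : EuclideanSpace ℝ (Fin 3), fderiv ℝ χ x (curl (u τ) x) = 0) →
                      ∫ x, χ x * ⟪u τ x, curl (u τ) x⟫ = 0 := by
  intro ρ hρ hρ2 u p H c hcls T₁ M κ hdrift hκρ hpers τ hτ χ R hR hχ
  obtain ⟨hsw, hH, hgauge⟩ := hcls
  obtain ⟨hcl, hT₁, hM0, hκ1, _henv, _hgrad⟩ := hdrift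
  -- the helicity `h`; suppose it is non-zero
  set h : ℝ := ∫ x, χ x * ⟪u τ x, curl (u τ) x⟫ with hh
  by_contra hne
  have hh2 : 0 < h ^ 2 := by positivity
  -- gauges
  have hA : ∀ a : ℝ, 0 < a →
      ENNReal.ofReal (a ^ (2 * ρ)) * cknA a (0 : ℝ × EuclideanSpace ℝ (Fin 3)) u ≤ (c : ℝ≥0∞) :=
    fun a ha => (le_self_add.trans le_self_add).trans (hgauge a ha)
  have hE : ∀ a : ℝ, 0 < a →
      ENNReal.ofReal (a ^ ρ) * cknE a (0 : ℝ × EuclideanSpace ℝ (Fin 3)) H ≤ (c : ℝ≥0∞) :=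
    fun a ha => (le_add_self.trans le_self_add).trans (hgauge a ha)
  -- regularity of the slices
  have hC1 : ∀ t : ℝ, t < 0 → ContDiff ℝ 1 (u t) := fun t ht => (hcl.contDiff_velocity ht).of_le (by norm_cast)
  have hmeas : ∀ t : ℝ, t < 0 → Measurable (u t) := fun t ht => (hC1 t ht).continuous.measurable
  have hmeas_curl : ∀ t : ℝ, t < 0 → Measurable (curl (u t)) := fun t ht => (continuous_curl (hC1 t ht)).measurable
  have hτ0 : τ < 0 := lt_of_lt_of_le hτ hT₁
  -- exponents: `γ = min 2 (1-κ)⁻¹ > 2 - 3ρ`, `ε = γ - (2 - 3ρ) > 0`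
  have h1κ : 0 < 1 - κ := by linarith
  obtain ⟨γ, hγ⟩ : ∃ γ : ℝ, γ = min 2 (1 - κ)⁻¹ := ⟨_, rfl⟩
  have hγρ : 2 - 3 * ρ < γ := by rw [hγ]; exact exponent_race hκ1 hρ (by linarith) hκρ
  have hγ0 : 0 < γ := by rw [hγ]; exact lt_min two_pos (inv_pos.2 h1κ)
  have hε0 : 0 < γ - (2 - 3 * ρ) := by linarith
  -- constants
  set c' : ℝ := (c : ℝ) + 1 with hc'
  have hc'0 : 0 < c' := by rw [hc']; positivity
  have hcc' : (c : ℝ) ≤ c' := by rw [hc']; linarith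
  obtain ⟨c₁, hc₁⟩ : ∃ c₁ : ℝ, c₁ = (1 - κ) / (4 * (M + 1)) := ⟨_, rfl⟩
  have hc₁0 : 0 < c₁ := by rw [hc₁]; positivity
  obtain ⟨c₂, hc₂⟩ : ∃ c₂ : ℝ, c₂ = min 1 (c₁ ^ (1 - κ)⁻¹) := ⟨_, rfl⟩
  have hc₂0 : 0 < c₂ := by rw [hc₂]; exact lt_min one_pos (Real.rpow_pos_of_pos hc₁0 _)
  obtain ⟨K, hK⟩ : ∃ K : ℝ, K = 32 * c' ^ 2 / (c₂ * h ^ 2) := ⟨_, rfl⟩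
  have hK0 : 0 < K := by rw [hK]; positivity
  -- a large radius `a`: `a ≥ 1`, `a ≥ 2R`, `c₂ a^γ ≥ 2|τ|`, `a^ε > K`
  have hev1 : ∀ᶠ a : ℝ in atTop, 2 * (-τ) ≤ c₂ * a ^ γ :=
    ((tendsto_rpow_atTop hγ0).const_mul_atTop hc₂0).eventually_ge_atTop _
  have hev2 : ∀ᶠ a : ℝ in atTop, K < a ^ (γ - (2 - 3 * ρ)) :=
    (tendsto_rpow_atTop hε0).eventually_gt_atTop _
  obtain ⟨a, haA, hwinτ, hrace⟩ := ((eventually_ge_atTop (max 1 (2 * R))).and (hev1.and hev2)).exists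
  have ha1 : 1 ≤ a := le_trans (le_max_left _ _) haA
  have haR : 2 * R ≤ a := le_trans (le_max_right _ _) haA
  have ha0 : 0 < a := by linarith
  -- the usable window `(-L_a, τ)`
  obtain ⟨La, hLa⟩ : ∃ La : ℝ, La = min (a ^ 2) ((c₁ * a) ^ (1 - κ)⁻¹) := ⟨_, rfl⟩
  have hLa_sq : La ≤ a ^ 2 := by rw [hLa]; exact min_le_left _ _
  have hLa_c : La ≤ (c₁ * a) ^ (1 - κ)⁻¹ := by rw [hLa]; exact min_le_right _ _
  have hLa_ge : c₂ * a ^ γ ≤ La := by rw [hLa, hc₂, hγ]; exact window_le_rpow_min ha1 hc₁0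
  have hLa_τ : 2 * (-τ) ≤ La := hwinτ.trans hLa_ge
  -- the enstrophy floor on every slice of the window
  obtain ⟨Fa, hFa⟩ : ∃ Fa : ℝ, Fa = h ^ 2 / (c' * a ^ (1 - 2 * ρ)) := ⟨_, rfl⟩
  have haρ : 0 < a ^ (1 - 2 * ρ) := Real.rpow_pos_of_pos ha0 _
  have hFa0 : 0 < Fa := by rw [hFa]; positivity
  have hslice : ∀ s ∈ Ioo (-La) τ,
      ENNReal.ofReal Fa ≤ ∫⁻ x in ball (0 : EuclideanSpace ℝ (Fin 3)) a, ENNReal.ofReal (‖curl (u s) x‖ ^ 2) := by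
    intro s hs
    have hs0 : s < 0 := hs.2.trans hτ0
    obtain ⟨χ', ⟨_, hχ'1, hχ'0, _⟩, hχ'h⟩ := hpers τ hτ χ R hR hχ s hs.2
    -- the avatar's ball sits inside `B(0,a)`
    have hdrift : M / (1 - κ) * ((-s) ^ (1 - κ) - (-τ) ^ (1 - κ)) ≤ a / 4 :=
      drift_le_quarter hM0 h1κ hc₁ ha0 (by linarith) (by linarith) (by linarith [hs.1])
    have hRa : R + M / (1 - κ) * ((-s) ^ (1 - κ) - (-τ) ^ (1 - κ)) ≤ a := by linarith
    have hball : ball (0 : EuclideanSpace ℝ (Fin 3)) (R + M / (1 - κ) * ((-s) ^ (1 - κ) - (-τ) ^ (1 - κ))) ⊆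
        ball (0 : EuclideanSpace ℝ (Fin 3)) a := ball_subset_ball hRa
    -- Cauchy–Schwarz + the `A`-gauge
    have hcs := sq_integral_le_lintegral_mul_lintegral (hmeas s hs0) (hmeas_curl s hs0) hχ'1 hχ'0
    rw [hχ'h] at hcs
    have hsI : s ∈ Ioo (-(a ^ 2)) 0 := ⟨by linarith [hs.1], hs0⟩
    have hAs : ∫⁻ x in ball (0 : EuclideanSpace ℝ (Fin 3)) a, ‖u s x‖ₑ ^ 2 ≤ ENNReal.ofReal (c' * a ^ (1 - 2 * ρ)) :=
      (Backward.lintegral_ball_le_of_gaugeA ha0 (hA a ha0) hsI).trans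
        (ENNReal.ofReal_le_ofReal (mul_le_mul_of_nonneg_right hcc' haρ.le))
    have hkey : ENNReal.ofReal (h ^ 2) ≤ ENNReal.ofReal (c' * a ^ (1 - 2 * ρ)) *
        ∫⁻ x in ball (0 : EuclideanSpace ℝ (Fin 3)) a, ENNReal.ofReal (‖curl (u s) x‖ ^ 2) :=
      hcs.trans (mul_le_mul' ((lintegral_mono_set hball).trans hAs) (lintegral_mono_set hball))
    -- divide
    have hne0 : ENNReal.ofReal (c' * a ^ (1 - 2 * ρ)) ≠ 0 := by
      rw [ENNReal.ofReal_ne_zero_iff]; positivity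
    have hdiv : ENNReal.ofReal (h ^ 2) / ENNReal.ofReal (c' * a ^ (1 - 2 * ρ)) ≤
        ∫⁻ x in ball (0 : EuclideanSpace ℝ (Fin 3)) a, ENNReal.ofReal (‖curl (u s) x‖ ^ 2) := by
      rw [ENNReal.div_le_iff hne0 ENNReal.ofReal_ne_top, mul_comm]
      exact hkey
    have heq : ENNReal.ofReal Fa = ENNReal.ofReal (h ^ 2) / ENNReal.ofReal (c' * a ^ (1 - 2 * ρ)) := by
      rw [hFa, ENNReal.ofReal_div_of_pos (by positivity)]
    rw [heq]
    exact hdiv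
  -- integrate over the usable window and compare with the budget
  have hIoo : Ioo (-La) τ ⊆ Ioo (-a ^ 2) 0 := Ioo_subset_Ioo (by linarith) hτ0.le
  have hwin : ENNReal.ofReal (Fa * (τ - -La)) ≤ ENNReal.ofReal (16 * ((c : ℝ) * a ^ (1 - ρ))) := by
    calc ENNReal.ofReal (Fa * (τ - -La)) = ENNReal.ofReal Fa * ENNReal.ofReal (τ - -La) :=
          ENNReal.ofReal_mul hFa0.le
      _ = ∫⁻ _ in Ioo (-La) τ, ENNReal.ofReal Fa := by rw [setLIntegral_const, Real.volume_Ioo]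
      _ ≤ ∫⁻ s in Ioo (-La) τ, ∫⁻ x in ball (0 : EuclideanSpace ℝ (Fin 3)) a, ENNReal.ofReal (‖curl (u s) x‖ ^ 2) :=
          setLIntegral_mono' measurableSet_Ioo hslice
      _ ≤ ∫⁻ s in Ioo (-a ^ 2) 0, ∫⁻ x in ball (0 : EuclideanSpace ℝ (Fin 3)) a, ENNReal.ofReal (‖curl (u s) x‖ ^ 2) :=
          lintegral_mono_set hIoo
      _ ≤ ENNReal.ofReal (16 * ((c : ℝ) * a ^ (1 - ρ))) := lintegral_window_sq_curl_le hH hcl hE ha0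
  have hbudget : Fa * (τ + La) ≤ 16 * c' * a ^ (1 - ρ) := by
    have h1 := (ENNReal.ofReal_le_ofReal_iff (by positivity)).1 hwin
    have e : τ - -La = τ + La := by ring
    rw [e] at h1
    have h2 : 16 * ((c : ℝ) * a ^ (1 - ρ)) ≤ 16 * c' * a ^ (1 - ρ) := by
      have := Real.rpow_pos_of_pos ha0 (1 - ρ)
      nlinarith
    linarith
  -- the race, as arithmetic: `c₂ h² a^γ / 2 ≤ Fa (τ + L_a) c' a^{1-2ρ} ≤ 16 c'² a^{2-3ρ}`
  have hLa2 : La / 2 ≤ τ + La := by linarith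
  have h3 : h ^ 2 * (La / 2) ≤ 16 * c' ^ 2 * a ^ (2 - 3 * ρ) := by
    have e1 : h ^ 2 = Fa * (c' * a ^ (1 - 2 * ρ)) := by rw [hFa]; field_simp
    have e2 : a ^ (2 - 3 * ρ) = a ^ (1 - ρ) * a ^ (1 - 2 * ρ) := by
      rw [← Real.rpow_add ha0]; congr 1; ring
    calc h ^ 2 * (La / 2) = Fa * (La / 2) * (c' * a ^ (1 - 2 * ρ)) := by rw [e1]; ring
      _ ≤ Fa * (τ + La) * (c' * a ^ (1 - 2 * ρ)) :=
          mul_le_mul_of_nonneg_right (mul_le_mul_of_nonneg_left hLa2 hFa0.le) (by positivity)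
      _ ≤ 16 * c' * a ^ (1 - ρ) * (c' * a ^ (1 - 2 * ρ)) := mul_le_mul_of_nonneg_right hbudget (by positivity)
      _ = 16 * c' ^ 2 * a ^ (2 - 3 * ρ) := by rw [e2]; ring
  have h4 : c₂ * h ^ 2 * a ^ γ ≤ 32 * c' ^ 2 * a ^ (2 - 3 * ρ) := by
    have := mul_le_mul_of_nonneg_left hLa_ge hh2.le
    nlinarith
  -- `a^ε ≤ K`, contradiction
  have h5 : a ^ (γ - (2 - 3 * ρ)) ≤ K := by
    have ha23 : 0 < a ^ (2 - 3 * ρ) := Real.rpow_pos_of_pos ha0 _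
    have e : a ^ (γ - (2 - 3 * ρ)) = a ^ γ / a ^ (2 - 3 * ρ) := by
      rw [Real.rpow_sub ha0]
    rw [e, hK, div_le_div_iff₀ ha23 (by positivity)]
    have e3 : a ^ γ * (c₂ * h ^ 2) = c₂ * h ^ 2 * a ^ γ := by ring
    rw [e3]
    exact h4
  exact absurd h5 (not_le.2 hrace)

end Summit.NavierStokesRegularity.NavierStokesRegularity.Theorems.PowerGaugeEulerLiouville.HelicityTube

end
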